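import Summits.Ventures.HodgeRepro2.T5BergmanLadder

/-!
# The Casimir eigenvalue of the weighted Bergman model: `k (k - 2) / 2`

On the `K`-type basis `zⁿ` the ladder of `T5BergmanLadder` acts by `E₊ zⁿ = (k + n) z^{n+1}`,
`E₋ zⁿ = -n z^{n-1}`, `H zⁿ = (k + 2n) zⁿ`, so the Casimir element `C = ½ H² + E₊ E₋ + E₋ E₊` acts on
EVERY `zⁿ` by the same scalar

  `C zⁿ = (½ (k + 2n)² - n (k + n - 1) - (n + 1)(k + n)) zⁿ = ½ k (k - 2) · zⁿ`   (`casimir_monomial`),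

i.e. the model has infinitesimal character `½ k (k - 2) = 2 k_R (k_R - 1)` (`k = 2 k_R`; for `π₃⁺`,
`k = 3`: `3/2`) — the Casimir eigenvalue of the lowest-weight `𝔰𝔩₂`-module of lowest weight `k`,
independent of the `K`-type (`casimir_monomial_eq_zero_case`).  In the normalisation
`H² + 2 E₊ E₋ + 2 E₋ E₊` of the abstract model's `T5Sl2Casimir` (gen 15, row 108: scalar `μ (μ - 2)` on an
irreducible lowest-weight module of lowest weight `μ`) the scalar is `k (k - 2)` (`casimir_monomial_double`),
the same value at `μ = k` — the two computations agree.

Blind lane: Mathlib + the HodgeRepro2 prefix only; no sorry; axioms ⊆ {propext, Classical.choice,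
Quot.sound}.
-/

namespace Summit.Ventures.HodgeRepro2.T5BergmanCasimir

open T5BergmanLadder

/-- The scalar by which `C = ½ H² + E₊ E₋ + E₋ E₊` acts on `zⁿ`, assembled from the ladder
coefficients: `½ (k + 2n)² + (E₊ E₋ zⁿ)/zⁿ + (E₋ E₊ zⁿ)/zⁿ`. -/
noncomputable abbrev casimirScalar (k n : ℕ) : ℂ :=
  (1 / 2 : ℂ) * ((k : ℂ) + 2 * n) ^ 2 + ladderDown n * ladderUp k (n - 1) +
    ladderUp k n * ladderDown (n + 1)

/-- **The Casimir eigenvalue**: `C zⁿ = ½ k (k - 2) · zⁿ` for every `n ≥ 1`. -/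
theorem casimir_monomial (k n : ℕ) (hn : 1 ≤ n) :
    casimirScalar k n = (1 / 2 : ℂ) * (k : ℂ) * ((k : ℂ) - 2) := by
  unfold casimirScalar
  rw [raise_lower_monomial k n hn, lower_raise_monomial]
  ring

/-- The `n = 0` case: on the lowest-weight vector `E₋ 1 = 0`, and the value is the same `½ k (k - 2)`. -/
theorem casimir_lowest (k : ℕ) : casimirScalar k 0 = (1 / 2 : ℂ) * (k : ℂ) * ((k : ℂ) - 2) := by
  unfold casimirScalar ladderUp ladderDown
  push_cast
  ring

/-- **The Casimir scalar is independent of the `K`-type**: `C` acts on every `zⁿ` by the scalar of the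
lowest-weight vector — the infinitesimal character of the model. -/
theorem casimir_monomial_eq_zero_case (k n : ℕ) : casimirScalar k n = casimirScalar k 0 := by
  rcases Nat.eq_zero_or_pos n with rfl | hn
  · rfl
  · rw [casimir_monomial k n hn, casimir_lowest]

/-- **Row 108's normalisation** `H² + 2 E₊ E₋ + 2 E₋ E₊`: the scalar is `k (k - 2)` = the abstract model's
`μ (μ - 2)` at `μ = k`. -/
theorem casimir_monomial_double (k n : ℕ) : 2 * casimirScalar k n = (k : ℂ) * ((k : ℂ) - 2) := by
  rw [casimir_monomial_eq_zero_case, casimir_lowest]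
  ring

/-- In Rühl's variable `k = 2 k_R`: `½ k (k - 2) = 2 k_R (k_R - 1)`. -/
theorem casimir_ruhl (kR : ℕ) :
    (1 / 2 : ℂ) * ((2 * kR : ℕ) : ℂ) * (((2 * kR : ℕ) : ℂ) - 2) = 2 * (kR : ℂ) * ((kR : ℂ) - 1) := by
  push_cast
  ring

end Summit.Ventures.HodgeRepro2.T5BergmanCasimir
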